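import Summits.MatrixMultiplication.OmegaCensus.SmallFormats.MatMul229GF3Funnel
import HarnessLib

/-!
# ω-census family (a): the FUNNEL at `(8, 27)` over `𝔽₃` — either every rank-one plane carries `≤ 2` X-forms, or `σ ≥ 11` with a row AND a column of load `≥ 3`

Cell `pub-omega` (unit `pub-omega-tensor`, gen 39), topic `Summits/MatrixMultiplication/OmegaCensus` (sub-folder
`SmallFormats`). Framing (verbatim): lottery ticket; floor = certified bounds/negative ranges. HONEST FRAMING: the `(8,27)` twin of
`MatMul229GF3Funnel` (p729529): the first, pure-`omega` split of the successor's cover certificate «(8,27): census clauses ⇒ the count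
vector is one of the 492 kill-list completions (15 orbits K1–K15)» (tensor g39 memo ALL4-SAT-g39); the first branch is dead by
`Enum723.no_cnt827_col2` (p718035). Nothing here is a bound on any rank by itself; nothing on `ω`.

* `Enum723.funnel_827` — a `27`-term computation of `⟨2,2,8⟩` over `𝔽₃` with nowhere-zero X-marginal has EITHER all eight row/column
  loads `≤ 2`, OR `11 ≤ σ`, a row clause and a column clause of load `≥ 3`, and all loads `≤ 4`.
* `Enum723.tensorRank_228_gf3_eq_of_noLoadedPlane` — `R_𝔽₃(⟨2,2,8⟩) = 28` CONDITIONAL on the second branch being empty.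
-/

namespace Summit.MatrixMultiplication.OmegaCensus.SmallFormats

open Finset Matrix
open Literature.Computability.AlgebraicComplexity
open Summit.MatrixMultiplication.OmegaCensus.RankOnePlaneCapGeneral

namespace Enum723

/-- **The funnel at `(8,27)`**: all eight rank-one-plane loads `≤ 2`, or (`σ ≥ 11`, a row clause of load `≥ 3`, a column clause of
load `≥ 3`, all loads `≤ 4`). -/
theorem funnel_827 (β : BilinComp (mulBilin (ZMod 3) 2 2 8) (Fin 27)) (hm : ∀ i, xMarginal β i ≠ 0) :
    (∀ k, 32 ≤ k → k < 40 → load (cnt (xMarginal β)) k ≤ 2) ∨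
    (11 ≤ ∑ a ∈ Finset.Ico 24 40, cnt (xMarginal β) a ∧ (∃ k, 32 ≤ k ∧ k < 36 ∧ 3 ≤ load (cnt (xMarginal β)) k) ∧
      (∃ k, 36 ≤ k ∧ k < 40 ∧ 3 ≤ load (cnt (xMarginal β)) k) ∧ ∀ k, 32 ≤ k → k < 40 → load (cnt (xMarginal β)) k ≤ 4) := by
  set c := cnt (xMarginal β) with hc
  have h4 : ∀ k, 32 ≤ k → k < 40 → load c k ≤ 4 := fun k hk1 hk2 =>
    load_rowcol_le_four_3n3 (n := 8) (by norm_num) β hm k hk1 hk2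
  have hP : ∀ k, 32 ≤ k → k < 40 → 3 ≤ load c k → 2 * 8 + load c k ≤ (∑ a ∈ Finset.Ico 24 40, c a) + 8 :=
    fun k hk1 hk2 h3 => loaded_plane_clause (n := 8) (by norm_num) β hm k hk1 hk2 h3
  have hrows := sum_load_rows_eq c
  have hcols := sum_load_cols_eq c
  rw [Finset.sum_Ico_succ_top (by norm_num), Finset.sum_Ico_succ_top (by norm_num), Finset.sum_Ico_succ_top (by norm_num),
    Finset.sum_Ico_succ_top (by norm_num), Finset.Ico_self, Finset.sum_empty] at hrows hcols
  by_cases hall : ∀ k, 32 ≤ k → k < 40 → load c k ≤ 2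
  · exact Or.inl hall
  right
  push Not at hall
  obtain ⟨k₀, hk1, hk2, hk3⟩ := hall
  have l32 := h4 32 (by norm_num) (by norm_num)
  have l33 := h4 33 (by norm_num) (by norm_num)
  have l34 := h4 34 (by norm_num) (by norm_num)
  have l35 := h4 35 (by norm_num) (by norm_num)
  have l36 := h4 36 (by norm_num) (by norm_num)
  have l37 := h4 37 (by norm_num) (by norm_num)
  have l38 := h4 38 (by norm_num) (by norm_num)
  have l39 := h4 39 (by norm_num) (by norm_num)
  have pk := hP k₀ hk1 hk2 (by omega)
  have lk := h4 k₀ hk1 hk2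
  have hσ : 11 ≤ ∑ a ∈ Finset.Ico 24 40, c a := by omega
  refine ⟨hσ, ?_, ?_, h4⟩
  · by_contra hno
    push Not at hno
    have n32 : load c 32 < 3 := hno 32 (by norm_num) (by norm_num)
    have n33 : load c 33 < 3 := hno 33 (by norm_num) (by norm_num)
    have n34 : load c 34 < 3 := hno 34 (by norm_num) (by norm_num)
    have n35 : load c 35 < 3 := hno 35 (by norm_num) (by norm_num)
    omega
  · by_contra hno
    push Not at hno
    have n36 : load c 36 < 3 := hno 36 (by norm_num) (by norm_num)
    have n37 : load c 37 < 3 := hno 37 (by norm_num) (by norm_num)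
    have n38 : load c 38 < 3 := hno 38 (by norm_num) (by norm_num)
    have n39 : load c 39 < 3 := hno 39 (by norm_num) (by norm_num)
    omega

/-- **`R_𝔽₃(⟨2,2,8⟩) = 28`, conditional on the loaded branch being empty**: if no `27`-term `𝔽₃`-computation of `⟨2,2,8⟩` has `σ ≥ 11`
together with a row clause and a column clause of load `≥ 3`, then `R_𝔽₃(⟨2,2,8⟩) = 28` (Hopcroft–Kerr above, the census below). -/
theorem tensorRank_228_gf3_eq_of_noLoadedPlane
    (H : ∀ β : BilinComp (mulBilin (ZMod 3) 2 2 8) (Fin 27),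
      ¬ (11 ≤ ∑ a ∈ Finset.Ico 24 40, cnt (xMarginal β) a ∧ (∃ k, 32 ≤ k ∧ k < 36 ∧ 3 ≤ load (cnt (xMarginal β)) k) ∧
        (∃ k, 36 ≤ k ∧ k < 40 ∧ 3 ≤ load (cnt (xMarginal β)) k) ∧ ∀ k, 32 ≤ k → k < 40 → load (cnt (xMarginal β)) k ≤ 4)) :
    tensorRank (matMulTensor (ZMod 3) 2 2 8) = 28 := by
  classical
  have hw := tensorRank_matMulTensor_22n_gf3_window 8 (by norm_num)
  have hr : 27 ≤ tensorRank (matMulTensor (ZMod 3) 2 2 8) := by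
    have h' : max (3 * 8 + 2) ((36 * 8 + 10) / 11) = 27 := by norm_num
    omega
  have h28 : 28 ≤ tensorRank (matMulTensor (ZMod 3) 2 2 8) := by
    refine succ_le_tensorRank_22n_of_orbit_census (k := ZMod 3) (n := 8) 27 ∅ (fun β => ?_) (by simp)
    exfalso
    have hm := xMarginal_ne_zero_of_le_tensorRank hr β
    rcases funnel_827 β hm with hall | hloaded
    · obtain ⟨-, -, hQ, -, ht⟩ := cnt_clauses (C := 9) (xMarginal β) hm (xCaps3_xMarginal β) fun X₀ hX₀ => by
        have h := invLineCapHalfPlus_xMarginal (n := 8) (by norm_num) β X₀ hX₀; omega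
      exact no_cnt827_col2 _ (fun k hk1 hk2 => hall k (by omega) hk2) hQ ht
    · exact H β hloaded
  omega

end Enum723

end Summit.MatrixMultiplication.OmegaCensus.SmallFormats
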